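import Summits.AtomisticToContinuum.BoseEinsteinCondensation.Theorems.BECInsertionCorrectorCorrectorClosureTiltCorrectorLift
import Summits.AtomisticToContinuum.BoseEinsteinCondensation.Theorems.BECConjugateDominationHardCoreExtensionBoundedPositiveMinimiser
import HarnessLib

/-!
# The tilt family of weak corrector identities for the insertion log-amplitude
# (line `geometric-mean-corrector`, stub S4 `stub_tiltCorrector`, crux
# `BECInsertionCorrector.CorrectorClosure`, item stmt-AtomisticToContinuum-12058)

Supports (does not close) stmt-AtomisticToContinuum-12058: lands the registered stub
`stub_tiltCorrector` of the skeleton `Cruxes/CorrectorClosure/Lines/geometric_mean_corrector.lean`.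

For a BOUNDED admissible pair profile `w`, `L > 0`, and real positive `C¹` periodic states `Θ`
(`N` bodies) and `Φ` (`N + 1` bodies) attaining the periodic ground-state energies (finite), write
`a(Z) = |Θ(tail Z)|`, `b(Z) = |Φ(Z)|`, `ψ = −log(b/a) = log a − log b` (the insertion
log-amplitude), `F_s = a^{1−s} b^{s}` (`s ∈ ℝ`; `F_s² dZ ∝` the tilt `π_s` of the path from the
undressed law `a² dZ` to `|Φ|² dZ`, midpoint = geometric-mean law), `W(Z) = ∑_{j≥1} w^per(z₀ − zⱼ)`
(impurity–bath potential) and `μ_N = E₀(N+1) − E₀(N)`. **Theorem** (`stub_tiltCorrector`): for every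
`s`, `ψ` is a weak corrector (`IsWeakCorrector` of `WeightedCorrector.lean`) of the source
`g_s = (W − μ_N) + (2s − 1)|∇ψ|²` for the weight `F_s`:
`∫ ∇ψ·∇φ F_s² = ∫ g_s φ F_s²` for every periodic `C¹` test function `φ` on `(ℝ³)^{N+1}`
(generator `𝓛_s = 𝓛₀ − 2s∇ψ·∇`; `s = ½`: the LINEAR equation `−𝓛_{1/2}ψ = W − μ_N`; `s = 0, 1`: the
Riccati forms of the insertion and removal equations).

Proof (Davies' ground-state transform in weak `C¹` form). The weak Euler–Lagrange equations of the
two minimisers hold for ALL lattice-periodic `C¹` test functions (`tilt_el_all`, part I) and, for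
`a`, on `(ℝ³)^{N+1}` (`tilt_el_tail`, part II). Test the equation of `a` with `ζ₁ = φ a^{−2s} b^{2s}`
and that of `b` with `ζ₂ = φ a^{2−2s} b^{2s−2}`, so that `ζ₁a² = ζ₂b² = φF_s²`; split
`V_{N+1} = W + V_N∘tail` (part II) and subtract: `∫∇a·∇(ζ₁a) − ∫∇b·∇(ζ₂b) = ∫(W − μ_N)φF_s²`. The
pointwise identity `∇a·∇(ζ₁a) − ∇b·∇(ζ₂b) = F_s²∇ψ·∇φ + (1 − 2s)φF_s²|∇ψ|²` (product and chain rules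
for `pderiv`, then `field_simp; ring` componentwise) finishes.

References: E. B. Davies, *Heat kernels and spectral theory* (1989), §4.2 Thm 4.2.1 (ground-state
transform); M. Reed, B. Simon, *Methods of Modern Mathematical Physics IV* (1978), §XIII.1.
-/

noncomputable section

namespace Summit.AtomisticToContinuum.BoseEinsteinCondensation.Theorems.CorrectorClosure.GeometricMeanCorrector

open MeasureTheory Filter
open scoped ENNReal NNReal ComplexConjugate BigOperators
open Literature.MathematicalPhysics.QuantumManyBody.BoseGas
open Summit.AtomisticToContinuum.BoseEinsteinCondensation.Cruxes.StaticResponseBound.UvThomsonForceWave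
  (contDiff_norm_of_real measurable_periodicInteraction_of)
open Summit.AtomisticToContinuum.BoseEinsteinCondensation.Cruxes.HardCoreExtension.ThirdLawCurrentFloor
  (exists_periodizedPotential_le)

/-! ### The tilt family of weak corrector identities (stub S4 `stub_tiltCorrector`) -/

section Main

/-- **S4 `stub_tiltCorrector`: the tilt family of weak corrector identities** (Davies' ground-state
transform for the insertion log-amplitude, `C¹` weak form). For a BOUNDED admissible `w`, `L > 0`,
and real positive `C¹` periodic states `Θ` (`N` bodies), `Φ` (`N + 1` bodies) attaining the periodic
ground-state energies (finite), put `a = |Θ∘tail|`, `b = |Φ|`, `ψ = −log(b/a)`. Then for EVERY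
`s : ℝ`, `ψ` is a weak corrector (`IsWeakCorrector`, tested on all `C¹` periodic functions of
`(ℝ³)^{N+1}`) of the source `g_s = (W − μ_N) + (2s − 1)|∇ψ|²`, `W(Z) = ∑ⱼ w^{per}(z₀ − zⱼ)`,
`μ_N = E₀(N+1) − E₀(N)`, for the weight `F_s = a^{1−s} b^{s}`:
`∫ ∇ψ·∇φ F_s² = ∫ g_s φ F_s²`. Proof: the weak Euler–Lagrange equations of the two minimisers, valid
for ALL periodic `C¹` test functions by Bose symmetrisation (`tilt_el_all`) and, for `a`, lifted to
`(ℝ³)^{N+1}` by Fubini (`tilt_el_tail`), are tested on `ζ₁ = φ a^{−2s} b^{2s}` (for `a`) and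
`ζ₂ = φ a^{2−2s} b^{2s−2}` (for `b`), so that `ζ₁ a² = ζ₂ b² = φ F_s²`; the pair sum of `N + 1`
particles splits as `V_{N+1} = W + V_N∘tail` (`periodicInteraction_succ`), and the gradient
remainder is the pointwise identity
`∇a·∇(ζ₁a) − ∇b·∇(ζ₂b) = F_s² ∇ψ·∇φ + (1 − 2s) φ F_s² |∇ψ|²`.
[cite: Davies1989, §4.2 Thm 4.2.1 (ground-state transform)] -/
theorem stub_tiltCorrector :
    ∀ (w : ℝ → ℝ≥0∞), IsRepulsiveFiniteRange w → (∃ M : ℝ≥0∞, M ≠ ⊤ ∧ ∀ r, w r ≤ M) →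
      ∀ (N : ℕ) (L : ℝ), 0 < L →
        ∀ (Θ : PeriodicTrialState N L) (Φ : PeriodicTrialState (N + 1) L),
          (∀ X, Θ.ψ X = (‖Θ.ψ X‖ : ℂ) ∧ 0 < ‖Θ.ψ X‖) →
          (∀ Z, Φ.ψ Z = (‖Φ.ψ Z‖ : ℂ) ∧ 0 < ‖Φ.ψ Z‖) →
          periodicEnergy w Θ = periodicGroundStateEnergy w N L →
          periodicEnergy w Φ = periodicGroundStateEnergy w (N + 1) L →
          periodicEnergy w Θ ≠ ⊤ → periodicEnergy w Φ ≠ ⊤ →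
          ∀ (ψ : Config (N + 1) → ℝ),
            (ψ = fun Z => -Real.log (‖Φ.ψ Z‖ / ‖Θ.ψ (Fin.tail Z)‖)) →
            ∀ s : ℝ,
              IsWeakCorrector L
                (fun Z : Config (N + 1) => ‖Θ.ψ (Fin.tail Z)‖ ^ (1 - s) * ‖Φ.ψ Z‖ ^ s)
                (fun Z : Config (N + 1) =>
                  (∑ j : Fin N, (periodizedPotential w L (Z 0 - Z j.succ)).toReal)
                    - ((periodicGroundStateEnergy w (N + 1) L).toReal
                        - (periodicGroundStateEnergy w N L).toReal)
                    + (2 * s - 1) * gradDot ψ ψ Z)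
                ψ := by
  intro w hw hwM N L hL Θ Φ hΘ hΦ hΘE hΦE hΘfin hΦfin ψ hψ s
  have hwm : Measurable w := hw.1
  obtain ⟨C, hC⟩ := exists_periodizedPotential_le hw hwM hL
  have hΘreal : ∀ X, Θ.ψ X = (‖Θ.ψ X‖ : ℂ) := fun X => (hΘ X).1
  have hΦreal : ∀ Z, Φ.ψ Z = (‖Φ.ψ Z‖ : ℂ) := fun Z => (hΦ Z).1
  -- notation: `a = |Θ∘tail|`, `b = |Φ|` (opaque names)
  obtain ⟨a, ha⟩ : ∃ a : Config (N + 1) → ℝ, a = fun Z => ‖Θ.ψ (Fin.tail Z)‖ := ⟨_, rfl⟩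
  obtain ⟨b, hb⟩ : ∃ b : Config (N + 1) → ℝ, b = fun Z => ‖Φ.ψ Z‖ := ⟨_, rfl⟩
  have ha' : ∀ Z, ‖Θ.ψ (Fin.tail Z)‖ = a Z := fun Z => by rw [ha]
  have hb' : ∀ Z, ‖Φ.ψ Z‖ = b Z := fun Z => by rw [hb]
  have ha0 : ∀ Z, 0 < a Z := fun Z => by rw [← ha']; exact (hΘ _).2
  have hb0 : ∀ Z, 0 < b Z := fun Z => by rw [← hb']; exact (hΦ Z).2
  have hFΘ : ContDiff ℝ 1 fun Y => ‖Θ.ψ Y‖ := contDiff_norm_of_real Θ hΘreal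
  have haC : ContDiff ℝ 1 a := by rw [ha]; exact tilt_contDiff_comp_tail hFΘ
  have hbC : ContDiff ℝ 1 b := by rw [hb]; exact contDiff_norm_of_real Φ hΦreal
  have had : Differentiable ℝ a := haC.differentiable one_ne_zero
  have hbd : Differentiable ℝ b := hbC.differentiable one_ne_zero
  have htail_add : ∀ Z W : Config (N + 1), Fin.tail (Z + W) = Fin.tail Z + Fin.tail W :=
    fun Z W => rfl
  have haper : IsLatticePeriodic L a := by
    rw [ha]; intro Z i k
    show ‖Θ.ψ (Fin.tail (Z + Pi.single i (EuclideanSpace.single k L)))‖ = ‖Θ.ψ (Fin.tail Z)‖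
    obtain rfl | ⟨j, rfl⟩ := Fin.eq_zero_or_eq_succ i
    · rw [htail_add, tilt_tail_single_zero, add_zero]
    · rw [htail_add, tilt_tail_single_succ, Θ.periodic]
  have hbper : IsLatticePeriodic L b := by
    rw [hb]; intro Z i k
    show ‖Φ.ψ (Z + Pi.single i (EuclideanSpace.single k L))‖ = ‖Φ.ψ Z‖
    rw [Φ.periodic]
  -- the log-amplitude `ψ = log a - log b`
  have hψ' : ψ = fun Z => Real.log (a Z) - Real.log (b Z) := by
    rw [hψ]; funext Z; rw [ha', hb', Real.log_div (hb0 Z).ne' (ha0 Z).ne']; ring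
  have hψC : ContDiff ℝ 1 ψ := by
    rw [hψ']; exact (haC.log fun Z => (ha0 Z).ne').sub (hbC.log fun Z => (hb0 Z).ne')
  have hψd : Differentiable ℝ ψ := hψC.differentiable one_ne_zero
  have hψper : IsLatticePeriodic L ψ := by
    rw [hψ']; intro Z i k
    show Real.log (a (Z + _)) - Real.log (b (Z + _)) = Real.log (a Z) - Real.log (b Z)
    rw [haper, hbper]
  have hdψ : ∀ (Z : Config (N + 1)) (i : Fin (N + 1)) (k : Fin 3),
      pderiv i k ψ Z = (a Z)⁻¹ * pderiv i k a Z - (b Z)⁻¹ * pderiv i k b Z := by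
    intro Z i k
    rw [hψ', show (fun Z => Real.log (a Z) - Real.log (b Z)) =
        (fun Z => Real.log (a Z)) - fun Z => Real.log (b Z) from rfl,
      pderiv_sub ((had Z).log (ha0 Z).ne') ((hbd Z).log (hb0 Z).ne'),
      pderiv_log (had Z) (ha0 Z).ne', pderiv_log (hbd Z) (hb0 Z).ne']
  refine ⟨⟨hψC, hψper⟩, fun φ hφ => ?_⟩
  have hφd : Differentiable ℝ φ := hφ.differentiable
  -- the real powers `u = a^{-2s}`, `v = b^{2s}`, `r = b^{2s-2}`
  obtain ⟨u, hu⟩ : ∃ u : Config (N + 1) → ℝ, u = fun Z => a Z ^ (-2 * s) := ⟨_, rfl⟩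
  obtain ⟨v, hv⟩ : ∃ v : Config (N + 1) → ℝ, v = fun Z => b Z ^ (2 * s) := ⟨_, rfl⟩
  obtain ⟨r, hr⟩ : ∃ r : Config (N + 1) → ℝ, r = fun Z => b Z ^ (2 * s - 2) := ⟨_, rfl⟩
  have huC : ContDiff ℝ 1 u := by rw [hu]; exact haC.rpow_const_of_ne fun Z => (ha0 Z).ne'
  have hvC : ContDiff ℝ 1 v := by rw [hv]; exact hbC.rpow_const_of_ne fun Z => (hb0 Z).ne'
  have hrC : ContDiff ℝ 1 r := by rw [hr]; exact hbC.rpow_const_of_ne fun Z => (hb0 Z).ne'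
  have hud : Differentiable ℝ u := huC.differentiable one_ne_zero
  have hvd : Differentiable ℝ v := hvC.differentiable one_ne_zero
  have hrd : Differentiable ℝ r := hrC.differentiable one_ne_zero
  have huper : IsLatticePeriodic L u := by rw [hu]; exact haper.comp fun t => t ^ (-2 * s)
  have hvper : IsLatticePeriodic L v := by rw [hv]; exact hbper.comp fun t => t ^ (2 * s)
  have hrper : IsLatticePeriodic L r := by rw [hr]; exact hbper.comp fun t => t ^ (2 * s - 2)
  have hdu : ∀ (Z : Config (N + 1)) (i : Fin (N + 1)) (k : Fin 3),
      pderiv i k u Z = -2 * s * (u Z / a Z) * pderiv i k a Z := by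
    intro Z i k; rw [hu]; exact tilt_pderiv_rpow_const_of_pos (had Z) (ha0 Z) _ i k
  have hdv : ∀ (Z : Config (N + 1)) (i : Fin (N + 1)) (k : Fin 3),
      pderiv i k v Z = 2 * s * (v Z / b Z) * pderiv i k b Z := by
    intro Z i k; rw [hv]; exact tilt_pderiv_rpow_const_of_pos (hbd Z) (hb0 Z) _ i k
  have hdr : ∀ (Z : Config (N + 1)) (i : Fin (N + 1)) (k : Fin 3),
      pderiv i k r Z = (2 * s - 2) * (r Z / b Z) * pderiv i k b Z := by
    intro Z i k; rw [hr]; exact tilt_pderiv_rpow_const_of_pos (hbd Z) (hb0 Z) _ i k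
  have hvr : ∀ Z, v Z = r Z * b Z ^ 2 := by
    intro Z; rw [hv, hr]
    show b Z ^ (2 * s) = b Z ^ (2 * s - 2) * b Z ^ 2
    rw [Real.rpow_sub (hb0 Z), Real.rpow_two, div_mul_cancel₀ _ (pow_ne_zero 2 (hb0 Z).ne')]
  have hF2 : ∀ Z, (a Z ^ (1 - s) * b Z ^ s) ^ 2 = a Z ^ 2 * u Z * v Z := by
    intro Z
    -- `(a^{1-s})² = a² a^{-2s}` and `(b^s)² = b^{2s}`
    have e1 : (a Z ^ (1 - s)) ^ 2 = a Z ^ 2 * a Z ^ (-2 * s) := by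
      conv_lhs => rw [← Real.rpow_natCast, ← Real.rpow_mul (ha0 Z).le, Nat.cast_ofNat,
        show (1 - s) * 2 = 2 + -2 * s by ring]
      rw [Real.rpow_add (ha0 Z), Real.rpow_two]
    have e2 : (b Z ^ s) ^ 2 = b Z ^ (2 * s) := by
      conv_lhs => rw [← Real.rpow_natCast, ← Real.rpow_mul (hb0 Z).le, Nat.cast_ofNat, mul_comm]
    rw [mul_pow, e1, e2, hu, hv]
  -- the test functions `ζ₁ = φ a^{-2s} b^{2s}` and `ζ₂ = φ a^{2-2s} b^{2s-2}`
  obtain ⟨ζ₁, hζ₁⟩ : ∃ ζ₁ : Config (N + 1) → ℝ, ζ₁ = fun Z => φ Z * u Z * v Z := ⟨_, rfl⟩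
  obtain ⟨ζ₂, hζ₂⟩ : ∃ ζ₂ : Config (N + 1) → ℝ, ζ₂ = fun Z => φ Z * a Z ^ 2 * u Z * r Z :=
    ⟨_, rfl⟩
  have hζ₁C : ContDiff ℝ 1 ζ₁ := by rw [hζ₁]; exact (hφ.1.mul huC).mul hvC
  have hζ₂C : ContDiff ℝ 1 ζ₂ := by rw [hζ₂]; exact ((hφ.1.mul (haC.pow 2)).mul huC).mul hrC
  have hζ₁d : Differentiable ℝ ζ₁ := hζ₁C.differentiable one_ne_zero
  have hζ₂d : Differentiable ℝ ζ₂ := hζ₂C.differentiable one_ne_zero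
  have hζ₁per : IsLatticePeriodic L ζ₁ := by
    rw [hζ₁]; intro Z i k
    show φ (Z + _) * u (Z + _) * v (Z + _) = φ Z * u Z * v Z
    rw [hφ.2, huper, hvper]
  have hζ₂per : IsLatticePeriodic L ζ₂ := by
    rw [hζ₂]; intro Z i k
    show φ (Z + _) * a (Z + _) ^ 2 * u (Z + _) * r (Z + _) = φ Z * a Z ^ 2 * u Z * r Z
    rw [hφ.2, haper, huper, hrper]
  have hζ₁a2 : ∀ Z, ζ₁ Z * a Z ^ 2 = φ Z * (a Z ^ (1 - s) * b Z ^ s) ^ 2 := by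
    intro Z; rw [hF2, hζ₁]; ring
  have hζ₂b2 : ∀ Z, ζ₂ Z * b Z ^ 2 = φ Z * (a Z ^ (1 - s) * b Z ^ s) ^ 2 := by
    intro Z; rw [hF2, hζ₂, hvr]; ring
  -- the two Euler–Lagrange equations
  have h1 : (∫ Z in cellN (N + 1) L, gradDot a (fun W => ζ₁ W * a W) Z) +
      (∫ Z in cellN (N + 1) L,
        (periodicInteraction w L (Fin.tail Z)).toReal * ζ₁ Z * a Z ^ 2) =
      (periodicEnergy w Θ).toReal * ∫ Z in cellN (N + 1) L, ζ₁ Z * a Z ^ 2 := by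
    rw [ha]; exact tilt_el_tail hwm hC Θ hΘreal hΘE hΘfin hζ₁C hζ₁per
  have h2 : (∫ Z in cellN (N + 1) L, gradDot b (fun W => ζ₂ W * b W) Z) +
      (∫ Z in cellN (N + 1) L, (periodicInteraction w L Z).toReal * ζ₂ Z * b Z ^ 2) =
      (periodicEnergy w Φ).toReal * ∫ Z in cellN (N + 1) L, ζ₂ Z * b Z ^ 2 := by
    rw [hb]; exact tilt_el_all (M := N + 1) hwm hΦreal hΦE hΦfin hζ₂C hζ₂per
  -- the potentials `W` (impurity–bath) and `Vt = V_N ∘ tail`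
  obtain ⟨W, hW⟩ : ∃ W : Config (N + 1) → ℝ,
      W = fun Z => ∑ j : Fin N, (periodizedPotential w L (Z 0 - Z j.succ)).toReal := ⟨_, rfl⟩
  obtain ⟨Vt, hVt⟩ : ∃ Vt : Config (N + 1) → ℝ,
      Vt = fun Z => (periodicInteraction w L (Fin.tail Z)).toReal := ⟨_, rfl⟩
  have hW' : ∀ Z, (∑ j : Fin N, (periodizedPotential w L (Z 0 - Z j.succ)).toReal) = W Z :=
    fun Z => by rw [hW]
  have hVt' : ∀ Z, (periodicInteraction w L (Fin.tail Z)).toReal = Vt Z := fun Z => by rw [hVt]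
  have hsplitV : ∀ Z, (periodicInteraction w L Z).toReal = W Z + Vt Z := fun Z => by
    rw [hW, hVt]; exact tilt_toReal_periodicInteraction_succ hC Z
  have hppne : ∀ x, periodizedPotential w L x ≠ ⊤ := fun x =>
    ne_top_of_le_ne_top ENNReal.coe_ne_top (hC x)
  have hWbd : ∀ Z, |W Z| ≤ N * C := by
    intro Z
    rw [hW, abs_of_nonneg (Finset.sum_nonneg fun j _ => ENNReal.toReal_nonneg)]
    calc ∑ j : Fin N, (periodizedPotential w L (Z 0 - Z j.succ)).toReal
        ≤ ∑ _j : Fin N, (C : ℝ) := Finset.sum_le_sum fun j _ => by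
          have h := ENNReal.toReal_mono ENNReal.coe_ne_top (hC (Z 0 - Z j.succ))
          rwa [ENNReal.coe_toReal] at h
      _ = N * C := by simp
  have hWm : Measurable W := by
    rw [hW]
    refine Finset.measurable_sum _ fun j _ => ?_
    exact ((measurable_periodizedPotential hwm L).comp
      ((measurable_config_apply 0).sub (measurable_config_apply j.succ))).ennreal_toReal
  have hVtbd : ∀ Z, |Vt Z| ≤ ((N * N : ℕ) : ℝ) * C := fun Z => by
    rw [hVt, abs_of_nonneg ENNReal.toReal_nonneg]
    have h := ENNReal.toReal_mono (ENNReal.mul_ne_top (ENNReal.natCast_ne_top _) ENNReal.coe_ne_top)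
      (periodicInteraction_le_of_bounded hC (Fin.tail Z))
    rwa [ENNReal.toReal_mul, ENNReal.toReal_natCast, ENNReal.coe_toReal] at h
  have hVtm : Measurable Vt := by
    rw [hVt]
    exact ((measurable_periodicInteraction_of hwm L).comp
      (measurable_pi_lambda _ fun j => measurable_pi_apply (Fin.succ j))).ennreal_toReal
  -- fold the notation into the goal and the two equations
  simp only [ha', hb', hW', dirichletFormW]
  simp only [hVt', hsplitV] at h1 h2
  -- continuity and integrability on the cell
  have hFsC : Continuous fun Z => (a Z ^ (1 - s) * b Z ^ s) ^ 2 :=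
    ((haC.continuous.rpow_const fun Z => Or.inl (ha0 Z).ne').mul
      (hbC.continuous.rpow_const fun Z => Or.inl (hb0 Z).ne')).pow 2
  have iT3 : IntegrableOn (fun Z => φ Z * (a Z ^ (1 - s) * b Z ^ s) ^ 2) (cellN (N + 1) L) :=
    integrableOn_cellN (hφ.continuous.mul hFsC) L
  have iTA : IntegrableOn (fun Z => gradDot a (fun W => ζ₁ W * a W) Z) (cellN (N + 1) L) :=
    integrableOn_cellN (continuous_gradDot haC (hζ₁C.mul haC)) L
  have iTB : IntegrableOn (fun Z => gradDot b (fun W => ζ₂ W * b W) Z) (cellN (N + 1) L) :=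
    integrableOn_cellN (continuous_gradDot hbC (hζ₂C.mul hbC)) L
  have iT4 : IntegrableOn (fun Z => gradDot ψ ψ Z * φ Z * (a Z ^ (1 - s) * b Z ^ s) ^ 2)
      (cellN (N + 1) L) :=
    integrableOn_cellN (((continuous_gradDot hψC hψC).mul hφ.continuous).mul hFsC) L
  have iTW : IntegrableOn (fun Z => W Z * (φ Z * (a Z ^ (1 - s) * b Z ^ s) ^ 2))
      (cellN (N + 1) L) :=
    Integrable.bdd_mul (c := N * C) iT3 hWm.aestronglyMeasurable
      (ae_of_all _ fun Z => by rw [Real.norm_eq_abs]; exact hWbd Z)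
  have iTVt : IntegrableOn (fun Z => Vt Z * (φ Z * (a Z ^ (1 - s) * b Z ^ s) ^ 2))
      (cellN (N + 1) L) :=
    Integrable.bdd_mul (c := ((N * N : ℕ) : ℝ) * C) iT3 hVtm.aestronglyMeasurable
      (ae_of_all _ fun Z => by rw [Real.norm_eq_abs]; exact hVtbd Z)
  -- the two equations in terms of `T3 = ∫ φ F²`, `TVt`, `TW`
  have h1' : (∫ Z in cellN (N + 1) L, gradDot a (fun W => ζ₁ W * a W) Z) +
      (∫ Z in cellN (N + 1) L, Vt Z * (φ Z * (a Z ^ (1 - s) * b Z ^ s) ^ 2)) =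
      (periodicGroundStateEnergy w N L).toReal *
        ∫ Z in cellN (N + 1) L, φ Z * (a Z ^ (1 - s) * b Z ^ s) ^ 2 := by
    have e2 : ∫ Z in cellN (N + 1) L, Vt Z * ζ₁ Z * a Z ^ 2 =
        ∫ Z in cellN (N + 1) L, Vt Z * (φ Z * (a Z ^ (1 - s) * b Z ^ s) ^ 2) :=
      integral_congr_ae (ae_of_all _ fun Z => by dsimp only; rw [mul_assoc, hζ₁a2])
    have e3 : ∫ Z in cellN (N + 1) L, ζ₁ Z * a Z ^ 2 =
        ∫ Z in cellN (N + 1) L, φ Z * (a Z ^ (1 - s) * b Z ^ s) ^ 2 :=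
      integral_congr_ae (ae_of_all _ fun Z => hζ₁a2 Z)
    rw [← e2, ← e3, ← hΘE]; exact h1
  have h2' : (∫ Z in cellN (N + 1) L, gradDot b (fun W => ζ₂ W * b W) Z) +
      ((∫ Z in cellN (N + 1) L, W Z * (φ Z * (a Z ^ (1 - s) * b Z ^ s) ^ 2)) +
        ∫ Z in cellN (N + 1) L, Vt Z * (φ Z * (a Z ^ (1 - s) * b Z ^ s) ^ 2)) =
      (periodicGroundStateEnergy w (N + 1) L).toReal *
        ∫ Z in cellN (N + 1) L, φ Z * (a Z ^ (1 - s) * b Z ^ s) ^ 2 := by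
    have e2 : ∫ Z in cellN (N + 1) L, (W Z + Vt Z) * ζ₂ Z * b Z ^ 2 =
        (∫ Z in cellN (N + 1) L, W Z * (φ Z * (a Z ^ (1 - s) * b Z ^ s) ^ 2)) +
          ∫ Z in cellN (N + 1) L, Vt Z * (φ Z * (a Z ^ (1 - s) * b Z ^ s) ^ 2) := by
      rw [← integral_add iTW iTVt]
      exact integral_congr_ae (ae_of_all _ fun Z => by dsimp only; rw [mul_assoc, hζ₂b2]; ring)
    have e3 : ∫ Z in cellN (N + 1) L, ζ₂ Z * b Z ^ 2 =
        ∫ Z in cellN (N + 1) L, φ Z * (a Z ^ (1 - s) * b Z ^ s) ^ 2 :=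
      integral_congr_ae (ae_of_all _ fun Z => hζ₂b2 Z)
    rw [← e2, ← e3, ← hΦE]; exact h2
  -- the pointwise gradient identity
  have hφu : ∀ Z, DifferentiableAt ℝ (fun Y => φ Y * u Y) Z := fun Z => (hφd Z).mul (hud Z)
  have ha2 : ∀ Z, DifferentiableAt ℝ (fun Y => a Y ^ 2) Z := fun Z => (had Z).pow 2
  have hφa2 : ∀ Z, DifferentiableAt ℝ (fun Y => φ Y * a Y ^ 2) Z := fun Z => (hφd Z).mul (ha2 Z)
  have hφa2u : ∀ Z, DifferentiableAt ℝ (fun Y => φ Y * a Y ^ 2 * u Y) Z :=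
    fun Z => (hφa2 Z).mul (hud Z)
  have hpt : ∀ Z, gradDot ψ φ Z * (a Z ^ (1 - s) * b Z ^ s) ^ 2 =
      gradDot a (fun W => ζ₁ W * a W) Z - gradDot b (fun W => ζ₂ W * b W) Z -
        (1 - 2 * s) * (gradDot ψ ψ Z * φ Z * (a Z ^ (1 - s) * b Z ^ s) ^ 2) := by
    intro Z
    rw [hF2 Z]
    have hterm : ∀ (i : Fin (N + 1)) (k : Fin 3),
        pderiv i k ψ Z * pderiv i k φ Z * (a Z ^ 2 * u Z * v Z) =
          (pderiv i k a Z * pderiv i k (fun W => ζ₁ W * a W) Z -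
            pderiv i k b Z * pderiv i k (fun W => ζ₂ W * b W) Z) -
          (1 - 2 * s) * (pderiv i k ψ Z * pderiv i k ψ Z * φ Z * (a Z ^ 2 * u Z * v Z)) := by
      intro i k
      have e1 : pderiv i k ζ₁ Z = φ Z * u Z * pderiv i k v Z +
          v Z * (φ Z * pderiv i k u Z + u Z * pderiv i k φ Z) := by
        rw [hζ₁, pderiv_fun_mul (hφu Z) (hvd Z), pderiv_fun_mul (hφd Z) (hud Z)]
      have e2 : pderiv i k ζ₂ Z = φ Z * a Z ^ 2 * u Z * pderiv i k r Z +
          r Z * (φ Z * a Z ^ 2 * pderiv i k u Z +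
            u Z * (φ Z * (2 * a Z * pderiv i k a Z) + a Z ^ 2 * pderiv i k φ Z)) := by
        rw [hζ₂, pderiv_fun_mul (hφa2u Z) (hrd Z), pderiv_fun_mul (hφa2 Z) (hud Z),
          pderiv_fun_mul (hφd Z) (ha2 Z), pderiv_fun_sq (had Z)]
      rw [pderiv_fun_mul (hζ₁d Z) (had Z), pderiv_fun_mul (hζ₂d Z) (hbd Z), e1, e2, hdu, hdv, hdr,
        hdψ]
      simp only [hζ₁, hζ₂]
      rw [hvr]
      have hA := (ha0 Z).ne'
      have hB := (hb0 Z).ne'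
      field_simp
      ring
    calc gradDot ψ φ Z * (a Z ^ 2 * u Z * v Z)
        = ∑ i : Fin (N + 1), ∑ k : Fin 3, pderiv i k ψ Z * pderiv i k φ Z * (a Z ^ 2 * u Z * v Z) := by
          simp only [gradDot, Finset.sum_mul]
      _ = ∑ i : Fin (N + 1), ∑ k : Fin 3,
            ((pderiv i k a Z * pderiv i k (fun W => ζ₁ W * a W) Z -
              pderiv i k b Z * pderiv i k (fun W => ζ₂ W * b W) Z) -
            (1 - 2 * s) * (pderiv i k ψ Z * pderiv i k ψ Z * φ Z * (a Z ^ 2 * u Z * v Z))) :=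
          Finset.sum_congr rfl fun i _ => Finset.sum_congr rfl fun k _ => hterm i k
      _ = gradDot a (fun W => ζ₁ W * a W) Z - gradDot b (fun W => ζ₂ W * b W) Z -
            (1 - 2 * s) * (gradDot ψ ψ Z * φ Z * (a Z ^ 2 * u Z * v Z)) := by
          simp only [gradDot, Finset.sum_sub_distrib, Finset.sum_mul, Finset.mul_sum]
  -- integrate the pointwise identity
  have iAB : IntegrableOn (fun Z => gradDot a (fun W => ζ₁ W * a W) Z -
      gradDot b (fun W => ζ₂ W * b W) Z) (cellN (N + 1) L) := iTA.sub iTB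
  have iT4c : IntegrableOn (fun Z => (1 - 2 * s) *
      (gradDot ψ ψ Z * φ Z * (a Z ^ (1 - s) * b Z ^ s) ^ 2)) (cellN (N + 1) L) :=
    iT4.const_mul _
  have hL : ∫ Z in cellN (N + 1) L, gradDot ψ φ Z * (a Z ^ (1 - s) * b Z ^ s) ^ 2 =
      (∫ Z in cellN (N + 1) L, gradDot a (fun W => ζ₁ W * a W) Z) -
        (∫ Z in cellN (N + 1) L, gradDot b (fun W => ζ₂ W * b W) Z) -
        (1 - 2 * s) *
          ∫ Z in cellN (N + 1) L, gradDot ψ ψ Z * φ Z * (a Z ^ (1 - s) * b Z ^ s) ^ 2 := by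
    rw [integral_congr_ae (ae_of_all _ hpt), integral_sub iAB iT4c, integral_sub iTA iTB,
      integral_const_mul]
  -- expand the right-hand side
  have iμ : IntegrableOn (fun Z => ((periodicGroundStateEnergy w (N + 1) L).toReal -
      (periodicGroundStateEnergy w N L).toReal) * (φ Z * (a Z ^ (1 - s) * b Z ^ s) ^ 2))
      (cellN (N + 1) L) := iT3.const_mul _
  have iT4c' : IntegrableOn (fun Z => (2 * s - 1) *
      (gradDot ψ ψ Z * φ Z * (a Z ^ (1 - s) * b Z ^ s) ^ 2)) (cellN (N + 1) L) :=
    iT4.const_mul _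
  have iWμ : IntegrableOn (fun Z => W Z * (φ Z * (a Z ^ (1 - s) * b Z ^ s) ^ 2) -
      ((periodicGroundStateEnergy w (N + 1) L).toReal -
        (periodicGroundStateEnergy w N L).toReal) * (φ Z * (a Z ^ (1 - s) * b Z ^ s) ^ 2))
      (cellN (N + 1) L) := iTW.sub iμ
  have hR : ∫ Z in cellN (N + 1) L, (W Z - ((periodicGroundStateEnergy w (N + 1) L).toReal -
      (periodicGroundStateEnergy w N L).toReal) + (2 * s - 1) * gradDot ψ ψ Z) * φ Z *
        (a Z ^ (1 - s) * b Z ^ s) ^ 2 =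
      (∫ Z in cellN (N + 1) L, W Z * (φ Z * (a Z ^ (1 - s) * b Z ^ s) ^ 2)) -
        ((periodicGroundStateEnergy w (N + 1) L).toReal -
            (periodicGroundStateEnergy w N L).toReal) *
          (∫ Z in cellN (N + 1) L, φ Z * (a Z ^ (1 - s) * b Z ^ s) ^ 2) +
        (2 * s - 1) *
          ∫ Z in cellN (N + 1) L, gradDot ψ ψ Z * φ Z * (a Z ^ (1 - s) * b Z ^ s) ^ 2 := by
    have hpt' : ∀ Z, (W Z - ((periodicGroundStateEnergy w (N + 1) L).toReal -
        (periodicGroundStateEnergy w N L).toReal) + (2 * s - 1) * gradDot ψ ψ Z) * φ Z *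
          (a Z ^ (1 - s) * b Z ^ s) ^ 2 =
        W Z * (φ Z * (a Z ^ (1 - s) * b Z ^ s) ^ 2) -
          ((periodicGroundStateEnergy w (N + 1) L).toReal -
            (periodicGroundStateEnergy w N L).toReal) * (φ Z * (a Z ^ (1 - s) * b Z ^ s) ^ 2) +
          (2 * s - 1) * (gradDot ψ ψ Z * φ Z * (a Z ^ (1 - s) * b Z ^ s) ^ 2) := fun Z => by
      ring
    rw [integral_congr_ae (ae_of_all _ hpt'), integral_add iWμ iT4c', integral_sub iTW iμ,
      integral_const_mul, integral_const_mul]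
  rw [hL, hR]
  linarith [h1', h2']

end Main

end Summit.AtomisticToContinuum.BoseEinsteinCondensation.Theorems.CorrectorClosure.GeometricMeanCorrector

end
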